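import Literature.RepresentationTheory.FiniteGroups.VershikKerovMaxDegreeProofs
import Literature.RepresentationTheory.FiniteGroups.VershikKerovHookIntegral
import Mathlib.Analysis.SpecialFunctions.Stirling
import HarnessLib

/-!
# The Vershik–Kerov upper bound: reduction to the limit-shape expansion of the hook integral

Topic `Literature/RepresentationTheory/FiniteGroups`; third file on the named fact
`VershikKerov1985_maxCharDegree` (`VershikKerovMaxDegree.lean`: for every `ε > 0` and large `n`,
`√(n!) e^{-(c₁+ε)√n} ≤ D(n) ≤ √(n!) e^{-(c₂-ε)√n}`, `D(n) = maxCharDegree 𝔖ₙ`, `c₂ = (π-2)/π²`).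
`VershikKerovMaxDegreeProofs.lean` proved the lower half and reduced the fact to the hook-product
estimate `∏_{c ∈ μ} h(c) ≥ √(n!) e^{(c₂-ε)√n}`; `VershikKerovHookIntegral.lean` proved
`K(h) ≤ log h` (Vershik–Kerov's Lemma 1 as an inequality) and `S_N ≥ 16 c₂ √N - 2` (the size of the
diagonal slices). This file assembles them with Stirling's formula: PROVED here

* `log_factorial_le` — `log n! ≤ n log n - n + (log n)/2 + 1` (`n ≥ 1`, from Mathlib's monotonicity
  of the Stirling sequence);
* `exists_nat_log_div_four_add_le_mul_sqrt` — `(log n)/4 + C ≤ ε√n` for large `n`;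
* `vkJCells μ = J(μ) := ∑_{c ∈ μ} K(h(c))` (the hook integral of the lattice boundary of `μ`, cell
  by cell) and `vkJCells_le_log_prod_hookLength` — `J(μ) ≤ log ∏ h(c)`;
* **`VershikKerov1985_maxCharDegree_of_hookIntegral_bound`** — the named fact FOLLOWS from the
  single analytic inequality
  `(LSVK)  ∀ N ≥ 1, ∀ μ ⊢ N:  J(μ) ≥ ½(N log N - N) + S_N/16`,
  the diagonal-slices corollary of Vershik–Kerov's exact expansion of the hook integral around the
  limit shape, `J(f) = ½(N log N - N) + (1/16) θ_N(f) + ½ θ̄_N(f)` (Vershik–Kerov 1985, Lemmas 2–4;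
  Mkrtchyan 2012, Prop. 4.1; Aggarwal–Elboim 2026, Prop. 2.1), via `θ̄_N ≥ 0` and `θ_N(f_μ) ≥ S_N`.

(LSVK) is exactly what remains of Vershik–Kerov's proof to be formalised (the `H^{1/2}` identity
`-∬ log|x-y| g'(x)g'(y) = ½‖g‖²_{1/2}` and the logarithmic potential of the arcsine law); it is a
hypothesis here, NOT a named fact, and this file does NOT discharge `VershikKerov1985_maxCharDegree`.
It was checked numerically (all `μ ⊢ N`, `N ≤ 22`; Plancherel samples to `N = 1600`): the slack
`J(μ) - ½(N log N - N) - S_N/16` is `≥ 0.33` and grows like `√N`.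

## References

* A. M. Vershik, S. V. Kerov, Funct. Anal. Appl. 19 (1985) 21–31. [VershikKerov1985]
* S. Mkrtchyan, Europ. J. Combin. 33 (2012) 1631–1652, arXiv:1008.3854, Prop. 3.1, Prop. 4.1, §5.
  [Mkrtchyan2012]
* A. Aggarwal, D. Elboim, arXiv:2605.25995 (2026), Prop. 2.1. [AggarwalElboim2026]
* I. Pak, G. Panova, D. Yeliussizov, J. Combin. Theory Ser. A 165 (2019), §2.3. [PakPanovaYeliussizov2019]

## Mathlib and tree

Mathlib: `Stirling.log_stirlingSeq_formula`, `Stirling.log_stirlingSeq'_antitone`,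
`Stirling.stirlingSeq_one`, `Real.log_le_sub_one_of_pos`, `Real.log_prod`. Tree:
`VershikKerov1985_maxCharDegree_of_prod_hookLength_bound`, `vkUpperConst`
(`VershikKerovMaxDegreeProofs.lean`, `VershikKerovMaxDegree.lean`); `vkHookKernel_le_log`,
`vkDiagSum_ge` (`VershikKerovHookIntegral.lean`); `hookLength`, `one_le_hookLength`
(`Literature/NumberTheory/DiophantineGeometry/PartitionTableaux.lean`).
-/

noncomputable section

open Real Finset
open scoped BigOperators

namespace Literature.RepresentationTheory.FiniteGroups
/-! ### Stirling's upper bound and a growth lemma -/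

/-- **`log n! ≤ n log n - n + (log n)/2 + 1`** for `n ≥ 1` (the Stirling sequence
`n!/(√(2n)(n/e)ⁿ)` decreases from its value `e/√2` at `n = 1`; Mathlib `Stirling`). [folklore] -/
theorem log_factorial_le {n : ℕ} (hn : 1 ≤ n) :
    Real.log (n.factorial : ℝ) ≤ n * Real.log n - n + Real.log n / 2 + 1 := by
  obtain ⟨k, rfl⟩ : ∃ k, n = k + 1 := ⟨n - 1, by omega⟩
  have hanti := Stirling.log_stirlingSeq'_antitone (Nat.zero_le k)
  simp only [Function.comp_apply, Nat.succ_eq_add_one, zero_add] at hanti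
  rw [Stirling.stirlingSeq_one, Stirling.log_stirlingSeq_formula] at hanti
  have hpos : (0 : ℝ) < ((k + 1 : ℕ) : ℝ) := by positivity
  rw [Real.log_div (Real.exp_pos 1).ne' (by positivity), Real.log_exp,
    Real.log_sqrt zero_le_two, Real.log_mul two_ne_zero hpos.ne',
    Real.log_div hpos.ne' (Real.exp_pos 1).ne', Real.log_exp] at hanti
  linarith

/-- `(log n)/4 + C ≤ ε √n` for all large `n` (with `t = n^{1/4}`: `log t ≤ t - 1` and
`t - 1 + C ≤ ε t²` once `ε t ≥ 1 + |C|`). [folklore] -/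
theorem exists_nat_log_div_four_add_le_mul_sqrt {ε : ℝ} (hε : 0 < ε) (C : ℝ) :
    ∃ n₀ : ℕ, 1 ≤ n₀ ∧ ∀ n : ℕ, n₀ ≤ n → Real.log n / 4 + C ≤ ε * Real.sqrt n := by
  -- `T` so large that `t ≥ T ⇒ t - 1 + C ≤ ε t²`
  set T : ℝ := max 1 ((1 + |C|) / ε) with hT
  have hT1 : 1 ≤ T := le_max_left _ _
  have hT2 : (1 + |C|) / ε ≤ T := le_max_right _ _
  have hT0 : 0 ≤ T := zero_le_one.trans hT1
  refine ⟨⌈T ^ 4⌉₊ + 1, Nat.succ_pos _, fun n hn => ?_⟩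
  have hn1 : (T ^ 4 : ℝ) ≤ n := by
    have h1 : (T ^ 4 : ℝ) ≤ ⌈T ^ 4⌉₊ := Nat.le_ceil _
    have h2 : ((⌈T ^ 4⌉₊ + 1 : ℕ) : ℝ) ≤ n := by exact_mod_cast hn
    push_cast at h2
    linarith
  have hn0 : (0 : ℝ) < n := lt_of_lt_of_le (by positivity) hn1
  -- `t = n^{1/4} = √(√n)`
  set t : ℝ := Real.sqrt (Real.sqrt n) with ht
  have ht0 : 0 < t := Real.sqrt_pos.mpr (Real.sqrt_pos.mpr hn0)
  have htt : t ^ 2 = Real.sqrt n := Real.sq_sqrt (Real.sqrt_nonneg _)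
  have htT : T ≤ t := by
    rw [ht, Real.le_sqrt hT0 (Real.sqrt_nonneg _), Real.le_sqrt (sq_nonneg _) hn0.le]
    nlinarith
  -- `log n / 4 = log t ≤ t - 1`
  have hlog : Real.log n / 4 = Real.log t := by
    rw [ht, Real.log_sqrt (Real.sqrt_nonneg _), Real.log_sqrt hn0.le]
    ring
  have hlt : Real.log t ≤ t - 1 := Real.log_le_sub_one_of_pos ht0
  have ht1 : 1 ≤ t := hT1.trans htT
  have hεt : 1 + |C| ≤ ε * t := by
    have := (div_le_iff₀ hε).mp (hT2.trans htT)
    linarith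
  have hC : C ≤ |C| := le_abs_self C
  have h6 : (1 + |C|) * t ≤ ε * t * t := mul_le_mul_of_nonneg_right hεt ht0.le
  have h7 : |C| ≤ |C| * t := le_mul_of_one_le_right (abs_nonneg C) ht1
  rw [hlog, ← htt, sq]
  linarith

/-! ### The cell sum `J(μ)` and the reduction -/

open Literature.NumberTheory.DiophantineGeometry (hookLength one_le_hookLength)

variable {n : ℕ}

/-- `J(μ) := ∑_{c ∈ μ} K(h(c))`, the **hook integral** of the lattice boundary of `μ`, cell by
cell (`K(h) = ∫₀¹∫₀¹ log(h + t - s) dt ds`, `vkHookKernel`, is the contribution of the pair of unit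
boundary steps at distance `h` bounding the hook of `c`; Vershik–Kerov 1985, Lemma 1 /
Mkrtchyan 2012, Prop. 3.1: `θ(λ) = 1 + 2∬_{D_λ} log h_λ` is `J` after rescaling by `√n`).
[cite: VershikKerov1985, Lemma 1] [cite: Mkrtchyan2012, Prop. 3.1] -/
def vkJCells (μ : Nat.Partition n) : ℝ :=
  ∑ c ∈ μ.youngDiagram.cells, vkHookKernel (hookLength μ.youngDiagram c)

/-- **`J(μ) ≤ log ∏_{c ∈ μ} h(c)`** (Vershik–Kerov 1985, Lemma 1: `∑_c log h(c)² = 2J + ∑_c φ(h(c))`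
with `φ ≥ 0`; here summed from `K(h) ≤ log h`, `vkHookKernel_le_log`). [cite: VershikKerov1985, Lemma 1] -/
theorem vkJCells_le_log_prod_hookLength (μ : Nat.Partition n) :
    vkJCells μ ≤ Real.log (∏ c ∈ μ.youngDiagram.cells, (hookLength μ.youngDiagram c : ℝ)) := by
  rw [Real.log_prod]
  · exact Finset.sum_le_sum fun c hc => vkHookKernel_le_log (by exact_mod_cast one_le_hookLength hc)
  · intro c hc
    have h := one_le_hookLength hc
    positivity

/-- **Reduction of `VershikKerov1985_maxCharDegree` to the Logan–Shepp–Vershik–Kerov inequality.**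
Hypothesis `H` — for every `N ≥ 1` and every `μ ⊢ N`,
`J(μ) ≥ ½(N log N - N) + S_N/16` — is the diagonal-slices corollary of Vershik–Kerov's exact
expansion `J(f) = ½(N log N - N) + (1/16) θ_N(f) + ½ θ̄_N(f)` of the hook integral around the
limit shape `Ω_N` (Vershik–Kerov 1985, Lemmas 2–4; Aggarwal–Elboim 2026, Prop. 2.1), using
`θ̄_N ≥ 0` and `θ_N(f_μ) ≥ S_N` (lattice boundaries have slopes `±1`). Given `H`:
`log ∏ h ≥ J(μ) ≥ ½(N log N - N) + c₂√N - 1/8` (`vkDiagSum_ge`), while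
`½ log N! ≤ ½(N log N - N) + (log N)/4 + 1/2` (Stirling), so `∏ h ≥ √(N!) e^{(c₂-ε)√N}` for
large `N`, which is the hypothesis of `VershikKerov1985_maxCharDegree_of_prod_hookLength_bound`.
This theorem does NOT discharge the fact: `H` (the limit-shape analysis) remains to be proved.
[cite: VershikKerov1985, Thm. 1 (as quoted in Pak–Panova–Yeliussizov 2019, arXiv:1804.04693, §2.3 eq. (2.3))]
[cite: Mkrtchyan2012, Prop. 4.1 and §5] [cite: AggarwalElboim2026, Prop. 2.1] -/
theorem VershikKerov1985_maxCharDegree_of_hookIntegral_bound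
    (H : ∀ N : ℕ, 1 ≤ N → ∀ μ : Nat.Partition N,
      ((N : ℝ) * Real.log N - N) / 2 + vkDiagSum N / 16 ≤ vkJCells μ) :
    VershikKerov1985_maxCharDegree := by
  refine VershikKerov1985_maxCharDegree_of_prod_hookLength_bound fun ε hε => ?_
  obtain ⟨n₀, hn₀1, hn₀⟩ := exists_nat_log_div_four_add_le_mul_sqrt hε (5 / 8)
  refine ⟨n₀, fun n hn μ => ?_⟩
  have hn1 : 1 ≤ n := hn₀1.trans hn
  have hP : 0 < ∏ c ∈ μ.youngDiagram.cells, (hookLength μ.youngDiagram c : ℝ) :=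
    Finset.prod_pos fun c hc => by exact_mod_cast one_le_hookLength hc
  have hL : 0 < Real.sqrt (n.factorial : ℝ) * Real.exp ((vkUpperConst - ε) * Real.sqrt n) :=
    mul_pos (Real.sqrt_pos.mpr (by exact_mod_cast n.factorial_pos)) (Real.exp_pos _)
  rw [← Real.log_le_log_iff hL hP, Real.log_mul (Real.sqrt_pos.mpr
    (by exact_mod_cast n.factorial_pos)).ne' (Real.exp_pos _).ne', Real.log_exp,
    Real.log_sqrt (Nat.cast_nonneg _)]
  have h1 := vkJCells_le_log_prod_hookLength μ
  have h2 := H n hn1 μ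
  have h3 := vkDiagSum_ge hn1
  have h4 := log_factorial_le hn1
  have h5 := hn₀ n hn
  have hc : vkUpperConst = (4 / π - 8 / π ^ 2) / 4 := by
    unfold vkUpperConst
    field_simp
    ring
  rw [hc]
  nlinarith [Real.sqrt_nonneg (n : ℝ), h1, h2, h3, h4, h5]

end Literature.RepresentationTheory.FiniteGroups

end
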